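import Mathlib
import HarnessLib
import HarnessLib.Audit
import Summits.HodgeConjecture.Statement
import Literature.AlgebraicGeometry.HodgeTheory.WeilClasses
import Literature.AlgebraicGeometry.HodgeTheory.WeilClassesSixfolds
import Literature.AlgebraicGeometry.Motives.HyperbolicWeilType
import Literature.AlgebraicGeometry.Motives.AbelianVarietyCohomologyExteriorH1
import Literature.AlgebraicGeometry.Tropical.TorusCycles
import Literature.AlgebraicGeometry.Tropical.WeilFamily
import Literature.Geometry.Symplectic.TropicalLagrangianLift
import HarnessLib.Audit.Status.Attr

/-!
Route: MirrorBraneLift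

CLOSED (refuted) 2026-08-20T19:25:37Z by gate — reason: refuted:stmt-HodgeConjecture-18677 (LagrangianLift) by Summit.HodgeConjecture.HodgeConjecture.Theorems.MirrorBraneLiftLagrangianLift_refuted — note: repair grace of 72.0 h (deadline 2026-08-20T19:17:06Z) expired without a repair — closed by the gate. The file is kept as the record of this route; refuted decls are indexed as negative knowledge (`ledger negatives`).

# Route MirrorBraneLift — Weil classes are algebraic because tropical Weil cycles lift to Lagrangian
branes whose family-Floer mirrors are coherent sheaves

It suffices to show X = OneAlgebraicWeilClass: for every imaginary quadratic K = ℚ(√-d) and every m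
≥ 2, every abelian 2m-fold (A, φ), φ² = -d,
of SPLIT (hyperbolic) Weil type carries ONE non-zero algebraic class in its Weil plane W_K =
weilClassesOf A φ m d (existence form: the brane
produces one class; MiddleAll-type restatements of the summit give no existence, so X is not a cheap
specialisation of the Statement). X reaches the
Statement through three supports: ExteriorH1 (the named Literature fact H•(A(ℂ)) = ⋀•H¹, hypothesis
of the tree lemma
weilClassesOf_le_algebraicClasses_iff_exists_ne_zero_of_dim_eq: W_K is an irreducible K-line, so one
non-zero algebraic Weil class gives all of W_K),
SplitToAll (ExteriorH1 → X → the whole Weil sector = the signature of stmt-2522 WeilClassesAlgebraic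
inlined: one-class-suffices + Schoen's product trick +
Weil classes are rational (n,n); imported, declared RESIDUAL for the tribunal together with Frame)
and the shared Weil-sector frame Frame = (Weil sector) →
HodgeConjecture (= stmt-14189 with stmt-2522 inlined; the canonical RESIDUAL). X itself is attacked
through the mirror: crux T (TropicalWeilSupply: an
effective tropical m-cycle with non-zero Weil functional on every very general tropical Weil torus),
crux A_R (LagrangianLiftR: every effective tropical
cycle presented FACE TO FACE — as a simplicial complex in the tropical torus — has a graded
geometric Lagrangian lift, Hicks Def. 3.0.2;
REPAIRED 2026-08-17 from LagrangianLift, refuted-misstated by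
Theorems.MirrorBraneLiftLagrangianLift_refuted: overlapping top cells pin two fibre
systems over one core point; the old decl stays as the negative edge) and the deciding bridge MR_R
(MirrorRealizationR: T → A_R → X, with the
standard face-to-face refinement step (R); successor of MirrorRealization, vacuous once A fell; rank
4 only
because it is stated over T and A_R — it is the hardest item: the family-Floer mirror functor
carrying the brane to a perfect complex on the very general
split Weil variety over the Novikov field, with non-zero Weil component of its Chern character, then
spreading). Realises card mirror-lagrangian-branes-for-weil-classes.
Lean: `∀ (m : ℕ), 2 ≤ m → ∀ (d : ℕ), 0 < d → ∀ (A :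
Literature.AlgebraicGeometry.Motives.AbelianVariety ℂ) (φ : A ⟶ A), A.dim = 2 * m →
Literature.AlgebraicGeometry.Motives.IsSmoothProjective (2 * m) A.X →
CategoryTheory.CategoryStruct.comp φ φ = -(d • CategoryTheory.CategoryStruct.id A) → ∀ (e :
Literature.AlgebraicGeometry.Motives.ProjectiveEmbedding A.X) (a :
Literature.AlgebraicGeometry.HodgeTheory.complexBetti
(Literature.AlgebraicGeometry.Motives.projectiveSpace e.n ℂ) 2),
Literature.AlgebraicGeometry.HodgeTheory.IsRationalClass a → a ≠ 0 →
Literature.AlgebraicGeometry.Motives.IsHyperbolicWeilType A φ m ((d : ℂ) •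
Literature.AlgebraicGeometry.HodgeTheory.complexBetti.map e.ι 2 a +
Literature.AlgebraicGeometry.HodgeTheory.complexBetti.map φ.hom.hom.hom 2
(Literature.AlgebraicGeometry.HodgeTheory.complexBetti.map e.ι 2 a)) → ∃ c :
Literature.AlgebraicGeometry.HodgeTheory.complexBetti A.X (2 * m), c ∈
Literature.AlgebraicGeometry.HodgeTheory.weilClassesOf A φ m d ∧ c ∈
Literature.AlgebraicGeometry.HodgeTheory.algebraicClasses A.X m ∧ c ≠ 0`

## Assembly
Pure logic: closes (hT : TropicalWeilSupply) (hA : LagrangianLiftR) (hMR : MirrorRealizationR) (hE :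
ExteriorH1) (hSplit : SplitToAll) (hFrame : Frame) :
HodgeConjecture := hFrame (hSplit hE (hMR hT hA)) (rev 1, route repair 2026-08-17; the rev-0
Assembly item over LagrangianLift/MirrorRealization is
proved and kept, those two decls are asides). The mathematics sits in MR_R (mirror functor), T
(tropical supply), A_R (lift); ExteriorH1 is a
classical Literature fact used by name; SplitToAll is the imported standard reduction (one class
suffices + product trick); Frame is the canonical residual (HC off the Weil sector).

Rationale: WHY THIS LINE. Along an irrational formal arc into the 0-dimensional cusp of the split Weil moduli
the universal family is one abelian variety A_H over the
Novikov field whose complex incarnations are the very general members and whose skeleton is the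
tropical Weil torus B_Q = ℝ²ⁿ/Qℤ²ⁿ
(Q ∈ 𝓛_δ⁺, the new Literature/Tropical/WeilFamily); A_H is the family-Floer mirror of the flat
symplectic torus 𝕏(B_Q) = T*B_Q/T*_ℤB_Q
(KontsevichSoibelman2010, Fukaya2002MirrorAbelian, Abouzaid2017FamilyFloerFaithful,
Abouzaid2021HMSWithoutCorrection, arXiv:1805.07924 §1.2).
A tropical Weil cycle V (T; MikhalkinZharkov2014Eigenwave Prop. 4.3 / Def. 6.1,
Zharkov2020TropicalWeil §2) lifts to a graded Lagrangian
L_V (A; Hicks2025Realizability Def. 3.0.2, Mikhalkin2019TropicalLagrangian, arXiv:1802.02993) whose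
(m,m)-Künneth component is cyc(V); if
L_V carries a bounding cochain the mirror functor returns a perfect complex on A_H whose Chern
character has non-zero Weil component, and ONE
such class makes the Weil plane algebraic (tree:
weilClassesOf_le_algebraicClasses_iff_exists_ne_zero), on the very general member hence
on the component (tree: TropicalCuspLift.BaireSpreading). Imported: symplectic topology / Floer
theory (branes, FOOO obstruction, family Floer)
and tropical geometry; no route in the tree and no entry of the negatives index uses a symplectic
object — the only tropical precedent,
TropicalCuspLift, died at DEPTH-ONE cusps on a K-balance obstruction (stmt-2620) that does not exist
at the totally toric cusp used here.

RANKED CRUXES. #0 OneAlgebraicWeilClass (target) — X — for all m ≥ 2 and d > 0, on every abelian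
2m-fold (A, φ), φ² = -d, of hyperbolic (split) Weil type (van Geemen: a rational φ-stable isotropic
2m-frame of H¹ for the polarisation d·h + φ^*h), there EXISTS a non-zero class in the Weil plane
weilClassesOf A φ m d which is algebraic (a ℂ-combination of cycle classes). Equivalent, given
ExteriorH1, to "all Weil classes of every hyperbolic (A, φ) are algebraic"
(Markman2025_weilClasses_algebraic_hyperbolicSixfold with 3 ↦ m) by
weilClassesOf_le_algebraicClasses_iff_exists_ne_zero_of_dim_eq. [difficulty: open-problem] (why it
might fail: open for every K as soon as m ≥ 4 (Weil 1977 candidates for HC counterexamples); known m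
= 2 (all K), m = 3 partially (Markman2025SecantWeil) — a hyperbolic Weil-type eightfold with W_K ∩
Alg = 0 kills it.) [Markman2025SecantWeil, Weil1977HodgeRing, vanGeemen1994HodgeAV,
MoonenZarhin1999]
#2 TropicalWeilSupply (crux) — T (card item, the tropical Hodge conjecture for Weil tori in supply
form): for every n ≥ 2, δ ≥ 1 and every VERY GENERAL member P of the tropical Weil family 𝓛_δ⁺ (Q =
(δQ₀, Q₂; -Q₂, Q₀) ≻ 0, n² algebraically independent coordinates) there is an effective tropical
n-cycle Z on B_Q = ℝ²ⁿ/Qℤ²ⁿ (MZ Def. 4.2/6.1, TropicalTorusCycle) whose ℚ(√-δ)-Weil functional Σ_σ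
w_σ a_σ det_ℂ(L_σ)² is non-zero, i.e. whose class has a non-zero Weil component. [difficulty: XL]
(why it might fail: Kontsevich expects the tropical Hodge conjecture to FAIL for very general Weil
tori already for n = 2 (Zharkov2020TropicalWeil §2: no counterexample found, n = 2 since settled
positively); for n ≥ 4 no effective Weil cycle is known and the sibling sketches bet on
non-existence at n = 4.) [Zharkov2020TropicalWeil, MikhalkinZharkov2014Eigenwave,
AminiPiquerez2020TropicalHC]
#3 LagrangianLift (aside; was crux) — REFUTED-MISSTATED 2026-08-17 by
Theorems.MirrorBraneLiftLagrangianLift_refuted (p172830; witness n = 2, δ = 1, Q = 1, ε = 1/10: two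
transversal flat 2-subtori of ℝ⁴/ℤ⁴, 4 triangles, crossing point interior to a top cell of each ⇒
IsConormalOver pins the fibre over it to translates of two different 2-subtori ⇒ 1/2 ∈ ℤ; variant:
one simplex listed twice with weights 1, 2). The statement quantified over ALL presentations,
including non-complexes with overlapping top cells; kept as the negative edge, superseded by #3′.
[Hicks2025Realizability]
#3′ LagrangianLiftR (crux) — A_R, REPAIRED A: for n ≥ 2, δ ≥ 1, every P ∈ 𝓛_δ⁺, every effective
tropical n-cycle V on B_Q whose presentation is FACE TO FACE modulo Qℤ²ⁿ (a simplicial complex in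
B_Q: any cell and any period-translate of any cell meet exactly in the convex hull of their common
vertices, and no two cell slots share a translated vertex set — Hicks's Def. 3.0.2 is about
polyhedral complexes, and every effective tropical cycle has such a refinement with the same
cells-as-current, MZ Prop. 4.3) and every ε > 0 there is a compact Hausdorff smooth 2n-manifold L
and f : L → 𝕏(B_Q) (CotangentTorus P.Q) which is a GRADED Lagrangian immersion, ε-close over the
base to |V|, and over the ε-core of every top cell equal to the periodised conormal sheets with
multiplicity w_σ, injectively (IsGeometricLift). The refuting witnesses violate the hypothesis;
their face-to-face subdivisions lift (disjoint union of flat Lagrangian tori, double points over the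
crossing vertex, outside every core). [difficulty: L] (why it might fail: Lifts in print only for
smooth (pair-of-pants) tropical curves/hypersurfaces and rigid curves in tropical abelian 3-folds
(arXiv:2502.16582); a tropical Weil n-cycle (Zharkov's E_H) need not be locally matroidal: no local
Lagrangian model at such faces, and GRADED smoothing can fail.) [Hicks2025Realizability,
arXiv:2502.16582, Mikhalkin2019TropicalLagrangian, arXiv:1802.02993, McDuffSalamon2017,
MikhalkinZharkov2014Eigenwave, Zharkov2020TropicalWeil]
#4 MirrorRealization (aside; was crux) — T → A → X became VACUOUS when A = LagrangianLift was
refuted (¬A proves it); superseded by #4′.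
#4′ MirrorRealizationR (crux) — MR_R = T → A_R → X (typed bridge of the informal cruxes R, U, F,
S1): tropical Weil supply AND face-to-face geometric Lagrangian lifting imply X — for (A, φ)
hyperbolic of Weil type, very general, realise A as ι(A_H), A_H = family-Floer mirror of 𝕏(B_Q);
take Z from T on B_Q; (R) refine Z face to face (common simplicial subdivision modulo Qℤ²ⁿ,
coincident cells merged: same cyc, same WeilFamily.functional ≠ 0; standard, MZ §4) and L_Z from
A_R; (U) L_Z admits a bounding cochain b; (F) the family Floer functor sends (L_Z, b) to a perfect
complex 𝔉 on A_H with pr_W ch_m(𝔉) = pr_W ι(cyc Z) ≠ 0; (S1) spreading: the non-zero algebraic Weil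
class on the very general member of each component of the hyperbolic Weil locus gives one on EVERY
member (flat transport of the absolute-Hodge Weil plane + Baire/Chow spreading, tree:
TropicalCuspLift.BaireSpreading) — so X, one class everywhere. [deps: TropicalWeilSupply,
LagrangianLiftR] [difficulty: XL] (why it might fail: U: for tropical curves a geometric lift is
unobstructed iff B-realizable (Hicks2025Realizability Thm 1.2), so L_V may bound Maslov-0 discs with
non-vanishing obstruction for m ≥ 3; F needs family Floer for immersed/obstructed branes (not in
print); (R) is routine.) [Hicks2025Realizability, Abouzaid2021HMSWithoutCorrection,
Abouzaid2017FamilyFloerFaithful, Hicks2020TropicalUnobstructed, arXiv:0803.0717, arXiv:2401.02577,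
KontsevichSoibelman2010]
#9 ExteriorH1 (support) — the named Literature fact (unproved in tree, classical: Mumford, Abelian
Varieties §1): for every complex abelian variety A, cup product identifies H•(A(ℂ), ℂ) with the
exterior algebra on H¹ and b₁ = 2 dim A — by name,
`Literature.AlgebraicGeometry.Motives.abelianVarietyCohomologyExteriorH1`; it is the hypothesis
under which the tree proves that the Weil plane is 2-dimensional and that one non-zero algebraic
Weil class gives all (weilClassesOf_le_algebraicClasses_iff_exists_ne_zero_of_dim_eq). Used as a
hypothesis (h : ExteriorH1); closes when the Literature fact is proved. [difficulty: L]
[vanGeemen1994HodgeAV, MoonenZarhin1999, Deligne1982HodgeCycles]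
#9 Frame (support) — RESIDUAL — the Weil-sector frame: the Hodge conjecture given the whole Weil
sector (all K = ℚ(√-d), all dimensions 2n ≥ 4, all discriminants; hypothesis = the signature of the
shared item stmt-HodgeConjecture-2522 `WeilClassesAlgebraic` inlined verbatim, so the decl is
definitionally HeckeOrbitCompactness.SummitOffWeilSector = stmt-14189). Shared by every Weil-sector
route; not attacked here. [difficulty: open-problem] [Deligne1982HodgeCycles, Andre1996Motifs,
MoonenZarhin1999]
#9 SplitToAll (support) — IMPORTED REDUCTION (declared residual for the tribunal with Frame; known
in print, M-sized in Lean): ExteriorH1 → X → the whole Weil sector (conclusion = signature of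
stmt-2522 `WeilClassesAlgebraic` verbatim). Three known steps: (i) one class suffices — W_K is an
irreducible K-line and algebraicClasses is φ^*-stable (tree:
weilClassesOf_le_algebraicClasses_iff_exists_ne_zero_of_dim_eq, under ExteriorH1); (ii) Schoen's
product trick — for (A, φ) of Weil type and (B, ψ) split of Weil type, (A × B, φ × ψ) is split and
W_K(A × B) restricts onto W_K(A) ⊗ W_K(B) (tree: weilClassesOf_le_algebraicClasses_of_prod,
HyperbolicWeilTypeProduct); (iii) a rational (n,n)-class in weilClassesOf is then algebraic.
[difficulty: M] [Schoen1998HodgeWeilAddendum, vanGeemen1994HodgeAV, MoonenZarhin1999,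
Markman2025SecantWeil]

TWO-LAYER PLAN. MR_R ⇐ lowRungs (T → A_R → X for m ≤ 3: the calibration range, m = 2 a theorem, m =
3 partially) → highRungs (T → A_R → X for m ≥ 4, the open
range; BC5 first rung = m = 4, d = 1, Gaussian hyperbolic eightfolds) → MR_R (the birth skeleton
MirrorRealizationBirth of the old MR carries over with A ↦ A_R, to be re-registered); the
mechanism-level
split BraneClass ⇐ U (bounding cochain, informal) → F (family Floer functor with ch-formula,
informal) → S1 (spreading) waits for Lean vocabulary.
T ⇐ baseTwo (n = 2, all δ) → foothold (products, n ≥ 3) → deform (to the very general member) → T.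
A_R ⇐ faceToFaceImmersedLift → grading → A_R (the registered skeleton
Cruxes/LagrangianLift/Lines/birth.lean carries over with the face-to-face hypothesis added to both
stubs).
SplitToAll ⇐ oneClassSuffices (tree lemma under ExteriorH1) → schoenProduct (tree:
HyperbolicWeilTypeProduct) → rationalWeilClasses — provable support.

KILL CRITERIA. refuted:TropicalWeilSupply (e.g. the sibling negative sketches prove no effective
tropical Weil 4-cycle exists on the very general ℚ(i)
16-torus) closes the route outright — with Zharkov's criterion it would even refute HC.
refuted:LagrangianLift as typed HAPPENED (2026-08-17, misstated: overlapping top cells; repaired by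
the face-to-face hypothesis, A_R).
refuted:LagrangianLiftR (a FACE-TO-FACE tropical cycle with no graded immersed lift) forces a pivot
to immersed lifts with bounding-cochain-corrected grading (restate A_R),
or kills the line if the obstruction is to any Lagrangian immersion conormal over the cores. A
disproof of U for m = 2
(where X is a theorem) kills the mechanism's calibration and retires the line as `not-a-mechanism`.
X (equivalently split Weil classes algebraic) proved elsewhere (HeckePrymWeil,
HeckeOrbitCompactness, NodalThetaWeil …) moots the route; Frame is shared and never decides between
Weil-sector routes.

NOT DECOMPOSED YET. U (existence of bounding cochains for L_V), F (family Floer functor for immersed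
branes with the Chern-character formula
ch_{m,m} = ι(PD[L]) + lower Künneth terms) and S1 (very general member ⇒ all members) have no Lean
vocabulary (no Fukaya category / FOOO
A_∞ algebra in Mathlib or Literature) and are carried INFORMALLY inside MirrorRealizationR's
docstring and as informal work items; the m = 2
calibration (K-holomorphic lift + Solomon–Verbitsky ⇒ tautologically unobstructed ⇒ Abouzaid) and
the first open rung m = 4, K = ℚ(i) are
stubs of the MR birth skeleton, not items. Constants (ε-cores, cell counts 148 for E_H) stay below
item level.

CHEAPEST FALSIFIER. Compute, for Zharkov's explicit 148-cell tropical Weil surface E_H (n = 2, δ =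
1), whether its conormal lift bounds a Maslov-index-0
holomorphic disc with non-zero count for the standard J (a finite polyhedral enumeration of tropical
discs with boundary on |E_H|, kit-sized):
a non-vanishing obstruction class in HF^2 there, where X is a THEOREM, would show the mechanism
cannot even re-prove van Geemen and retire
the line. Not run this cycle (needs the tropical disc enumerator; E_H's certificate exists in the
2001 archive).

NUMBERS. Known regime of X: m = 2 all K (Markman2025SecantWeil; Schoen, van Geemen, Koike), m = 3
for K = ℚ(√-3) det 1 (Schoen) and disc -1 cases
(arXiv:2502.03415); nothing for m ≥ 4, any K. Tropical side: dim U_m = 3 certified for m = 2, 3, 4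
(archive ml-l Thm 2.8); E_H has 148 cells,
cyc = 2θ₁² + w₀. Family 𝓛_δ has n² real parameters; very general = algebraically independent
coordinates.

DEFINITION REQUESTS. Landed this cycle as T0 Literature definitions (both ACCEPTED):
Literature/AlgebraicGeometry/Tropical/WeilFamily.lean (p169562:
WeilFamily.J, Polarization, coord, IsVeryGeneral, frameDet, functional — general δ over the sibling
TropicalTorusCycle of Tropical/TorusCycles)
and Literature/Geometry/Symplectic/TropicalLagrangianLift.lean (p169573: CotangentTorus,
cotangentSymplecticForm, IsLagrangianImmersion,
tangentFrame, IsGraded, cellHull/cellCore/conormalDir, IsConormalOver, IsGeometricLift). Still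
missing (not requested as items — no
realistic Mathlib path this quarter): filtered A_∞ algebra of a Lagrangian, bounding cochain, family
Floer functor; U/F/S1 stay informal.

Novelty: Searches (2026-08-17): lit search --hybrid "family Floer mirror functor abelian variety Weil classes
algebraic Lagrangian brane tropical cycle" (10 hits, none joining mirror symmetry to Weil classes:
Kerr–Pearlstein 2016, Green–Murre–Voisin 1994, McDuff–Salamon 2017, anon2016 Floer/binodal cubic);
lit vsearch "HMS for abelian varieties: Lagrangians lifting tropical cycles ↦ coherent sheaves whose
Chern classes give Weil-type Hodge classes" (10, none); lit search --hybrid "family Floer functor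
torus fibration without singular fibres tautologically unobstructed …" (8, none beyond textbooks);
lit galaxy search "tropical Lagrangian|Lagrangian lift|family Floer" --star all (13: Bocklandt HMS
intro, Kapustin–Kreuzer LNP 757, Evans torus fibrations, Hutchings families — no Weil/Hodge use);
lit galaxy search "Weil type|Weil classes" --star pdf (12, noise); lit galaxy search "bounding
cochain|immersed Lagrangian Floer|family Floer" --star pdf (6, FOOO cyclic symmetry, Hutchings); lit
read arxiv:2204.06432 / 1703.07898 / 2002.02347 / 1302.0252 (grep quotes in NOTES); ledger negatives
--problem HodgeConjecture; 62 Theses files grepped for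
TropicalTorusCycle|CotangentTorus|IsGeometricLift (0 routes).
Nearest prior art found: Hicks2025Realizability (arXiv:2204.06432, Thm 1.2 + p. 4: geometric lifts
of tropical curves/hypersurfaces, unobstructed iff B-realizable; mirror object a sheaf supported on
the realization — hypersurfaces only); Abouzaid2021HMSWithoutCorrection (arXiv:1703.07898 Thm  [refs: 2204.06432, 1703.07898, 2002.02347, arxiv:2204.06432]

Barriers (technique_class: mirror-symmetry, family-floer, tropical-lagrangian-lift): - technique_class: mirror-symmetry, family-floer, tropical-lagrangian-lift
- Literature.Barriers.HodgeConjecture.BabaeeHuh2017_HCplus_false: outside — T asks for ONE effective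
tropical cycle with non-zero Weil functional (either sign), never for a positive representative of a
prescribed class; Babaee–Huh's extremal currents obstruct HC⁺-style positive approximation, not
existence of one effective cycle pairing non-trivially with E₊.
- Literature.Barriers.HodgeConjecture.AtiyahHirzebruch1962_torsionClass_notAlgebraic: outside —
rational/complex coefficients throughout (the conclusion is membership in the ℂ-span
algebraicClasses; one non-zero class suffices by the K-line structure).
- Literature.Barriers.HodgeConjecture.Kollar1992_nonTorsionClass_notAlgebraic: outside — same (no
integrality claim; the brane's Chern character is used rationally).
- Literature.Barriers.HodgeConjecture.Andre1996_hodgeClassesOnAbelianVarieties_motivated: not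
applicable (refutation-direction no-go); consistent — the route proves algebraicity of exactly the
motivated-but-not-known-algebraic Weil classes.
- Literature.Barriers.HodgeConjecture.CattaniDeligneKaplan1995_hodgeLocus_algebraicFor: not
applicable as an obstruction; used positively — S1 spreads the class over components of the
(algebraic) hyperbolic Weil locus.
- Literature.Barriers.HodgeConjecture.Grothendieck1969_generalHodgeConjecture_false: not applicable
— no coniveau / generalized-Hodge statement is claimed; only middle-degree Weil clas

History (route lifecycle, newest last):
- 2026-08-17T19:17:06Z · BROKEN — LagrangianLift (stmt-HodgeConjecture-18677, aside) refuted by Summit.HodgeConjecture.HodgeConjecture.Theorems.MirrorBraneLiftLagrangianLift_refuted @ 3079c80db108 (refuter-rattack-stmt-HodgeConjecture-18677-0)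
- 2026-08-20T19:25:37Z · CLOSED refuted — refuted:stmt-HodgeConjecture-18677 (LagrangianLift) by Summit.HodgeConjecture.HodgeConjecture.Theorems.MirrorBraneLiftLagrangianLift_refuted (grace expired, auto-close) (gate)

sub-problem: HodgeConjecture · status: closed(refuted) · opened planner-type-f5a587f052-0 2026-08-17T16:56:58Z · rev 3 · ledger route-HodgeConjecture-MirrorBraneLift
GENERATED by the gate from the ledger (D-0016/17). Provers cite these decls: `theorem foo : Summit.HodgeConjecture.HodgeConjecture.Theses.MirrorBraneLift.<Decl> := …` in Summits/HodgeConjecture/HodgeConjecture/Theorems/<Name>.lean.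
-/

namespace Summit.HodgeConjecture.HodgeConjecture.Theses.MirrorBraneLift

open scoped BigOperators Topology Manifold Classical MeasureTheory ProbabilityTheory Matrix InnerProductSpace ComplexConjugate ContinuousMap
open Filter Set Function TopologicalSpace MeasureTheory

attribute [summit_statement] _root_.HodgeConjecture

/-- item stmt-HodgeConjecture-18675 · target · rank 0 · closed · moot by None · by planner
why it might fail: open for every K as soon as m ≥ 4 (Weil 1977 candidates for HC counterexamples); known m = 2 (all K), m = 3 partially (Markman2025SecantWeil) — a hyperbolic Weil-type eightfold with W_K ∩ Alg = 0 kills it.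
sources: Markman2025SecantWeil, Weil1977HodgeRing, vanGeemen1994HodgeAV, MoonenZarhin1999
[target] X — for all m ≥ 2 and d > 0, on every abelian 2m-fold (A, φ), φ² = -d, of hyperbolic
(split) Weil type (van Geemen: a rational φ-stable isotropic 2m-frame of H¹ for the polarisation d·h
+ φ^*h), there EXISTS a non-zero class in the Weil plane weilClassesOf A φ m d which is algebraic (a
ℂ-combination of cycle classes). Equivalent, given ExteriorH1, to "all Weil classes of every
hyperbolic (A, φ) are algebraic" (Markman2025_weilClasses_algebraic_hyperbolicSixfold with 3 ↦ m) by
weilClassesOf_le_algebraicClasses_iff_exists_ne_zero_of_dim_eq. [difficulty: open-problem] -/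
@[route_item "route-HodgeConjecture-MirrorBraneLift"]
def OneAlgebraicWeilClass : Prop :=
  ∀ (m : ℕ), 2 ≤ m → ∀ (d : ℕ), 0 < d → ∀ (A : Literature.AlgebraicGeometry.Motives.AbelianVariety ℂ) (φ : A ⟶ A), A.dim = 2 * m → Literature.AlgebraicGeometry.Motives.IsSmoothProjective (2 * m) A.X → CategoryTheory.CategoryStruct.comp φ φ = -(d • CategoryTheory.CategoryStruct.id A) → ∀ (e : Literature.AlgebraicGeometry.Motives.ProjectiveEmbedding A.X) (a : Literature.AlgebraicGeometry.HodgeTheory.complexBetti (Literature.AlgebraicGeometry.Motives.projectiveSpace e.n ℂ) 2), Literature.AlgebraicGeometry.HodgeTheory.IsRationalClass a → a ≠ 0 → Literature.AlgebraicGeometry.Motives.IsHyperbolicWeilType A φ m ((d : ℂ) • Literature.AlgebraicGeometry.HodgeTheory.complexBetti.map e.ι 2 a + Literature.AlgebraicGeometry.HodgeTheory.complexBetti.map φ.hom.hom.hom 2 (Literature.AlgebraicGeometry.HodgeTheory.complexBetti.map e.ι 2 a)) → ∃ c : Literature.AlgebraicGeometry.HodgeTheory.complexBetti A.X (2 * m),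 c ∈ Literature.AlgebraicGeometry.HodgeTheory.weilClassesOf A φ m d ∧ c ∈ Literature.AlgebraicGeometry.HodgeTheory.algebraicClasses A.X m ∧ c ≠ 0

/-- item stmt-HodgeConjecture-18676 · crux · rank 2 · closed · moot by None · by planner
why it might fail: Kontsevich expects the tropical Hodge conjecture to FAIL for very general Weil tori already for n = 2 (Zharkov2020TropicalWeil §2: no counterexample found, n = 2 since settled positively); for n ≥ 4 no effective Weil cycle is known and the sibling sketches bet on non-existence at n = 4.
sources: Zharkov2020TropicalWeil, MikhalkinZharkov2014Eigenwave, AminiPiquerez2020TropicalHC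
[crux] T (card item, the tropical Hodge conjecture for Weil tori in supply form): for every n ≥ 2, δ
≥ 1 and every VERY GENERAL member P of the tropical Weil family 𝓛_δ⁺ (Q = (δQ₀, Q₂; -Q₂, Q₀) ≻ 0, n²
algebraically independent coordinates) there is an effective tropical n-cycle Z on B_Q = ℝ²ⁿ/Qℤ²ⁿ
(MZ Def. 4.2/6.1, TropicalTorusCycle) whose ℚ(√-δ)-Weil functional Σ_σ w_σ a_σ det_ℂ(L_σ)² is
non-zero, i.e. whose class has a non-zero Weil component. [difficulty: XL] -/
@[route_item "route-HodgeConjecture-MirrorBraneLift", crux]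
def TropicalWeilSupply : Prop :=
  ∀ (n : ℕ), 2 ≤ n → ∀ (δ : ℕ), 1 ≤ δ → ∀ P : Literature.AlgebraicGeometry.Tropical.WeilFamily.Polarization n δ, P.IsVeryGeneral → ∃ Z : Literature.AlgebraicGeometry.Tropical.TropicalTorusCycle (2 * n) n P.Q, Literature.AlgebraicGeometry.Tropical.WeilFamily.functional δ Z ≠ 0

/-- item stmt-HodgeConjecture-19919 · crux · rank 3 · closed · moot by None · by planner
why it might fail: Lifts in print only for smooth (pair-of-pants) tropical curves/hypersurfaces and rigid curves in tropical abelian 3-folds (arXiv:2502.16582); a tropical Weil n-cycle (Zharkov's E_H) need not be locally matroidal: no local Lagrangian model at such faces, and GRADED smoothing can fail.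
sources: Hicks2025Realizability, arXiv:2502.16582, Mikhalkin2019TropicalLagrangian, arXiv:1802.02993, McDuffSalamon2017, MikhalkinZharkov2014Eigenwave
[crux] A_R — REPAIRED A (1:1 successor of LagrangianLift = stmt-HodgeConjecture-18677,
refuted-MISSTATED 2026-08-17 by Theorems.MirrorBraneLiftLagrangianLift_refuted, p172830: a
presentation with OVERLAPPING top cells — two transversal flat 2-subtori of ℝ⁴/ℤ⁴ crossing inside a
top cell of each, or one simplex listed twice — makes IsConormalOver pin two different sheet systems
over one core point). Hicks's geometric A-realizability for tropical cycles in tori, for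
FACE-TO-FACE presentations: for n ≥ 2, δ ≥ 1, every P ∈ 𝓛_δ⁺ and every effective tropical n-cycle V
on B_Q = ℝ²ⁿ/Qℤ²ⁿ presented as a SIMPLICIAL COMPLEX modulo Qℤ²ⁿ (hypothesis hV: any cell σ and any
period-translate σ' + Qz of any cell meet exactly in the convex hull of their common vertices, and
two cell slots with the same translated vertex set are the same slot with z = 0 — so distinct top
cells have disjoint relative interiors, crossing points are vertices of both sheets, every closed
cell embeds in B_Q; Hicks Def. 3.0.2 is about polyhedral complexes, and every effective tropical
cycle has such a refinement with the same cells-as-current, MikhalkinZharkov2014Eigenwave Prop. 4.3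
/ the presentation remark in Tropical/Tor -/
@[route_item "route-HodgeConjecture-MirrorBraneLift", crux]
def LagrangianLiftR : Prop :=
  ∀ (n : ℕ), 2 ≤ n → ∀ (δ : ℕ), 1 ≤ δ → ∀ (P : Literature.AlgebraicGeometry.Tropical.WeilFamily.Polarization n δ) (V : Literature.AlgebraicGeometry.Tropical.TropicalTorusCycle (2 * n) n P.Q), (∀ (σ σ' : Fin V.numCells) (z : Fin (2 * n) → ℤ), Literature.Geometry.Symplectic.cellHull P.Q V σ ∩ (fun b => b + P.Q *ᵥ (fun i => (z i : ℝ))) '' Literature.Geometry.Symplectic.cellHull P.Q V σ' ⊆ convexHull ℝ (Set.range (V.cell σ).vertex ∩ Set.range (fun k => (V.cell σ').vertex k + P.Q *ᵥ (fun i => (z i : ℝ)))) ∧ (Set.range (V.cell σ).vertex = Set.range (fun k => (V.cell σ').vertex k + P.Q *ᵥ (fun i => (z i : ℝ))) → σ = σ' ∧ z = 0)) → ∀ (ε : ℝ), 0 < ε → ∃ (L : Type) (_ : TopologicalSpace L) (_ : T2Space L) (_ : CompactSpace L) (_ : ChartedSpace (EuclideanSpace ℝ (Fin (2 * n))) L)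 (_ : IsManifold 𝓘(ℝ, EuclideanSpace ℝ (Fin (2 * n))) ((⊤ : ℕ∞) : WithTop ℕ∞) L) (f : L → Literature.Geometry.Symplectic.CotangentTorus P.Q), Literature.Geometry.Symplectic.IsGeometricLift P.Q V ε f

/-- item stmt-HodgeConjecture-19920 · crux · rank 4 · closed · moot by None · by planner
why it might fail: U: for tropical curves a geometric lift is unobstructed iff B-realizable (Hicks2025Realizability Thm 1.2), so L_V may bound Maslov-0 discs with non-vanishing obstruction for m ≥ 3; F needs family Floer for immersed/obstructed branes (not in print); (R) is routine.
sources: Hicks2025Realizability, Abouzaid2021HMSWithoutCorrection, Abouzaid2017FamilyFloerFaithful, Hicks2020TropicalUnobstructed, arXiv:0803.0717, arXiv:2401.02577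
[crux] MR_R — REPAIRED bridge (1:1 successor of MirrorRealization = stmt-HodgeConjecture-18678,
which became VACUOUS once LagrangianLift was refuted: T → A → X with ¬A): tropical Weil supply AND
face-to-face geometric Lagrangian lifting imply X — for (A, φ) hyperbolic of Weil type, very
general, realise A as ι(A_H), A_H = family-Floer mirror of 𝕏(B_Q); take Z from T on B_Q; (R) refine
Z face to face (common simplicial subdivision of the cells modulo Qℤ²ⁿ, crossing loci pushed into
the skeleton, coincident cells merged by adding weights: same cells-as-current, hence the same cyc
and the same WeilFamily.functional ≠ 0 — standard, MikhalkinZharkov2014Eigenwave §4) and take L_Z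
from A_R; (U) L_Z admits a bounding cochain b; (F) the family Floer functor sends (L_Z, b) to a
perfect complex 𝔉 on A_H with pr_W ch_m(𝔉) = pr_W ι(cyc Z) ≠ 0; (S1) spreading: the non-zero
algebraic Weil class on the very general member of each component of the hyperbolic Weil locus gives
one on EVERY member (flat transport of the absolute-Hodge Weil plane + Baire/Chow spreading, tree:
TropicalCuspLift.BaireSpreading) — so X, one class everywhere. [deps: TropicalWeilSupply,
LagrangianLiftR] [difficulty: XL] -/
@[route_item "route-HodgeConjecture-MirrorBraneLift", crux]
def MirrorRealizationR : Prop :=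
  TropicalWeilSupply → LagrangianLiftR → OneAlgebraicWeilClass

/-- item stmt-HodgeConjecture-18677 · aside · rank 3 · closed · refuted by Summit.HodgeConjecture.HodgeConjecture.Theorems.MirrorBraneLiftLagrangianLift_refuted @ 3079c80db108 (refuter) · by planner
why it might fail: geometric lifts exist in print only for smooth tropical curves and hypersurfaces (Hicks2025Realizability p. 4 conjectures A-realizability in general); codimension-n singular strata of a Weil n-cycle have no local model yet, and GRADED smoothing can fail at a vertex.
sources: Hicks2025Realizability, Mikhalkin2019TropicalLagrangian, arXiv:1802.02993, arXiv:1904.11780, McDuffSalamon2017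
[crux] A (card item, Hicks's geometric A-realizability for tropical cycles in tori): for n ≥ 2, δ ≥
1, every P ∈ 𝓛_δ⁺, every effective tropical n-cycle V on B_Q and every ε > 0 there is a compact
Hausdorff smooth 2n-manifold L and a map f : L → 𝕏(B_Q) = T*B_Q/T*_ℤB_Q (CotangentTorus P.Q) which
is a GRADED Lagrangian immersion, ε-close over the base to |V|, and over the ε-core of every top
cell equal to the periodised conormal sheets with multiplicity w_σ, injectively (IsGeometricLift,
Hicks Def. 3.0.2 adapted: immersed + graded). [difficulty: L] -/
@[route_item "route-HodgeConjecture-MirrorBraneLift"]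
def LagrangianLift : Prop :=
  ∀ (n : ℕ), 2 ≤ n → ∀ (δ : ℕ), 1 ≤ δ → ∀ (P : Literature.AlgebraicGeometry.Tropical.WeilFamily.Polarization n δ) (V : Literature.AlgebraicGeometry.Tropical.TropicalTorusCycle (2 * n) n P.Q) (ε : ℝ), 0 < ε → ∃ (L : Type) (_ : TopologicalSpace L) (_ : T2Space L) (_ : CompactSpace L) (_ : ChartedSpace (EuclideanSpace ℝ (Fin (2 * n))) L) (_ : IsManifold 𝓘(ℝ, EuclideanSpace ℝ (Fin (2 * n))) ((⊤ : ℕ∞) : WithTop ℕ∞) L) (f : L → Literature.Geometry.Symplectic.CotangentTorus P.Q), Literature.Geometry.Symplectic.IsGeometricLift P.Q V ε f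

/-- item stmt-HodgeConjecture-18678 · aside · rank 4 · closed · moot by None · by planner
why it might fail: U: for tropical curves a geometric lift is unobstructed iff B-realizable (Hicks2025Realizability Thm 1.2), so L_V may bound Maslov-0 discs with non-vanishing obstruction for m ≥ 3; F needs family Floer for immersed/obstructed branes (not in print).
sources: Hicks2025Realizability, Abouzaid2021HMSWithoutCorrection, Abouzaid2017FamilyFloerFaithful, Hicks2020TropicalUnobstructed, arXiv:0803.0717, arXiv:2401.02577
[crux] MR (typed bridge of the informal cruxes U, F, S1 of the card): tropical Weil supply AND
geometric Lagrangian lifting imply X — for (A, φ) hyperbolic of Weil type, very general, realise A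
as ι(A_H), A_H = family-Floer mirror of 𝕏(B_Q); take V from T on B_Q and L_V from A; (U) L_V admits
a bounding cochain b; (F) the family Floer functor sends (L_V, b) to a perfect complex 𝔉 on A_H with
pr_W ch_m(𝔉) = pr_W ι(cyc V) ≠ 0; (S1) spreading: the non-zero algebraic Weil class on the very
general member of each component of the hyperbolic Weil locus gives one on EVERY member (flat
transport of the absolute-Hodge Weil plane + Baire/Chow spreading, tree:
TropicalCuspLift.BaireSpreading) — so X, one class everywhere. [deps: TropicalWeilSupply,
LagrangianLift] [difficulty: XL] -/
@[route_item "route-HodgeConjecture-MirrorBraneLift"]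
def MirrorRealization : Prop :=
  TropicalWeilSupply → LagrangianLift → OneAlgebraicWeilClass

/-- item stmt-HodgeConjecture-18679 · support · rank 9 · closed · moot by None · by planner
sources: vanGeemen1994HodgeAV, MoonenZarhin1999, Deligne1982HodgeCycles
[support] the named Literature fact (unproved in tree, classical: Mumford, Abelian Varieties §1):
for every complex abelian variety A, cup product identifies H•(A(ℂ), ℂ) with the exterior algebra on
H¹ and b₁ = 2 dim A — by name,
`Literature.AlgebraicGeometry.Motives.abelianVarietyCohomologyExteriorH1`; it is the hypothesis
under which the tree proves that the Weil plane is 2-dimensional and that one non-zero algebraic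
Weil class gives all (weilClassesOf_le_algebraicClasses_iff_exists_ne_zero_of_dim_eq). Used as a
hypothesis (h : ExteriorH1); closes when the Literature fact is proved. [difficulty: L] -/
@[route_item "route-HodgeConjecture-MirrorBraneLift", crux]
def ExteriorH1 : Prop :=
  Literature.AlgebraicGeometry.Motives.abelianVarietyCohomologyExteriorH1

/-- item stmt-HodgeConjecture-18680 · support · rank 9 · closed · moot by None · by planner
sources: Deligne1982HodgeCycles, Andre1996Motifs, MoonenZarhin1999
[support] RESIDUAL — the Weil-sector frame: the Hodge conjecture given the whole Weil sector (all K
= ℚ(√-d), all dimensions 2n ≥ 4, all discriminants; hypothesis = the signature of the shared item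
stmt-HodgeConjecture-2522 `WeilClassesAlgebraic` inlined verbatim, so the decl is definitionally
HeckeOrbitCompactness.SummitOffWeilSector = stmt-14189). Shared by every Weil-sector route; not
attacked here. [difficulty: open-problem] -/
@[route_item "route-HodgeConjecture-MirrorBraneLift", crux]
def Frame : Prop :=
  (∀ (n : ℕ), 2 ≤ n → ∀ (d : ℕ), 0 < d → ∀ (A : Literature.AlgebraicGeometry.Motives.AbelianVariety ℂ) (φ : A ⟶ A), A.dim = 2 * n → Literature.AlgebraicGeometry.Motives.IsSmoothProjective (2 * n) A.X → CategoryTheory.CategoryStruct.comp φ φ = -(d • CategoryTheory.CategoryStruct.id A) → ∀ c : Literature.AlgebraicTopology.SingularHomology.singularCohomology ℂ ℂ (Literature.AlgebraicGeometry.Motives.ComplexPoints A.X) (2 * n), Literature.AlgebraicGeometry.HodgeTheory.IsRationalClass c → Literature.AlgebraicGeometry.HodgeTheory.IsOfHodgeType (2 * n) A.X (2 * n) n n c → (∃ c₁ c₂ : Literature.AlgebraicTopology.SingularHomology.singularCohomology ℂ ℂ (Literature.AlgebraicGeometry.Motives.ComplexPoints A.X) (2 * n), c = c₁ + c₂ ∧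 (∀ x y : ℕ, Literature.AlgebraicTopology.SingularHomology.singularCohomology.map ℂ ℂ (Literature.AlgebraicGeometry.Motives.AlgPoints.mapContinuous (L := ℂ) (x • CategoryTheory.CategoryStruct.id A + y • φ).hom.hom.hom) (2 * n) c₁ = ((x : ℂ) + (y : ℂ) * Complex.I * (Real.sqrt d : ℂ)) ^ (2 * n) • c₁) ∧ (∀ x y : ℕ, Literature.AlgebraicTopology.SingularHomology.singularCohomology.map ℂ ℂ (Literature.AlgebraicGeometry.Motives.AlgPoints.mapContinuous (L := ℂ) (x • CategoryTheory.CategoryStruct.id A + y • φ).hom.hom.hom) (2 * n) c₂ = ((x : ℂ) - (y : ℂ) * Complex.I * (Real.sqrt d : ℂ)) ^ (2 * n) • c₂)) → c ∈ Literature.AlgebraicGeometry.HodgeTheory.algebraicClasses A.X n) → HodgeConjecture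

/-- item stmt-HodgeConjecture-18681 · support · rank 9 · closed · moot by None · by planner
sources: Schoen1998HodgeWeilAddendum, vanGeemen1994HodgeAV, MoonenZarhin1999, Markman2025SecantWeil
[support] IMPORTED REDUCTION (declared residual for the tribunal with Frame; known in print, M-sized
in Lean): ExteriorH1 → X → the whole Weil sector (conclusion = signature of stmt-2522
`WeilClassesAlgebraic` verbatim). Three known steps: (i) one class suffices — W_K is an irreducible
K-line and algebraicClasses is φ^*-stable (tree:
weilClassesOf_le_algebraicClasses_iff_exists_ne_zero_of_dim_eq, under ExteriorH1); (ii) Schoen's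
product trick — for (A, φ) of Weil type and (B, ψ) split of Weil type, (A × B, φ × ψ) is split and
W_K(A × B) restricts onto W_K(A) ⊗ W_K(B) (tree: weilClassesOf_le_algebraicClasses_of_prod,
HyperbolicWeilTypeProduct); (iii) a rational (n,n)-class in weilClassesOf is then algebraic.
[difficulty: M] -/
@[route_item "route-HodgeConjecture-MirrorBraneLift", crux]
def SplitToAll : Prop :=
  ExteriorH1 → OneAlgebraicWeilClass → ∀ (n : ℕ), 2 ≤ n → ∀ (d : ℕ), 0 < d → ∀ (A : Literature.AlgebraicGeometry.Motives.AbelianVariety ℂ) (φ : A ⟶ A), A.dim = 2 * n → Literature.AlgebraicGeometry.Motives.IsSmoothProjective (2 * n) A.X → CategoryTheory.CategoryStruct.comp φ φ = -(d • CategoryTheory.CategoryStruct.id A) → ∀ c : Literature.AlgebraicTopology.SingularHomology.singularCohomology ℂ ℂ (Literature.AlgebraicGeometry.Motives.ComplexPoints A.X) (2 * n), Literature.AlgebraicGeometry.HodgeTheory.IsRationalClass c → Literature.AlgebraicGeometry.HodgeTheory.IsOfHodgeType (2 * n) A.X (2 * n) n n c → (∃ c₁ c₂ : Literature.AlgebraicTopology.SingularHomology.singularCohomology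 ℂ ℂ (Literature.AlgebraicGeometry.Motives.ComplexPoints A.X) (2 * n), c = c₁ + c₂ ∧ (∀ x y : ℕ, Literature.AlgebraicTopology.SingularHomology.singularCohomology.map ℂ ℂ (Literature.AlgebraicGeometry.Motives.AlgPoints.mapContinuous (L := ℂ) (x • CategoryTheory.CategoryStruct.id A + y • φ).hom.hom.hom) (2 * n) c₁ = ((x : ℂ) + (y : ℂ) * Complex.I * (Real.sqrt d : ℂ)) ^ (2 * n) • c₁) ∧ (∀ x y : ℕ, Literature.AlgebraicTopology.SingularHomology.singularCohomology.map ℂ ℂ (Literature.AlgebraicGeometry.Motives.AlgPoints.mapContinuous (L := ℂ) (x • CategoryTheory.CategoryStruct.id A + y • φ).hom.hom.hom) (2 * n) c₂ = ((x : ℂ) - (y : ℂ) * Complex.I * (Real.sqrt d : ℂ)) ^ (2 * n) • c₂)) → c ∈ Literature.AlgebraicGeometry.HodgeTheory.algebraicClasses A.X n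

/-- item stmt-HodgeConjecture-18682 · assembly · rank 1 · closed · proved by Summit.HodgeConjecture.HodgeConjecture.Theorems.mirrorBraneLift_assembly_proof @ 1c6f30e7348c (prover) · by planner
sources: Deligne1982HodgeCycles
[assembly] TropicalWeilSupply → LagrangianLift → MirrorRealization → ExteriorH1 → SplitToAll → Frame
→ HodgeConjecture -/
@[route_item "route-HodgeConjecture-MirrorBraneLift"]
def Assembly : Prop :=
  TropicalWeilSupply → LagrangianLift → MirrorRealization → ExteriorH1 → SplitToAll → Frame → HodgeConjecture

/-! D-0027 §2.1 — DECIDING THEOREM (planner-authored via `route open/edit --closes-file`; by planner-rrefute-HodgeConjecture-MirrorBraneLif-6584394c-0 2026-08-17T19:00:49Z) — ARCHIVED: route closed (refuted) 2026-08-20T19:25:37Z; kept so importers keep building: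
its hypotheses are this route's items and its conclusion the sub-problem Statement (glue_lint), and it elaborates with this file. -/

@[closes "route-HodgeConjecture-MirrorBraneLift"] theorem closes (hT : TropicalWeilSupply) (hA : LagrangianLiftR) (hMR : MirrorRealizationR)
    (hE : ExteriorH1) (hSplit : SplitToAll) (hFrame : Frame) : _root_.HodgeConjecture :=
  hFrame (hSplit hE (hMR hT hA))

end Summit.HodgeConjecture.HodgeConjecture.Theses.MirrorBraneLift
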